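import Literature.NumberTheory.Automorphic.SplitOrthogonalSatakeWeylInvariance
import Literature.NumberTheory.Automorphic.HyperspecialUnitarySatakeIsomorphismIntegral
import Literature.NumberTheory.Automorphic.SplitOrthogonalUnramifiedDatum
import HarnessLib

/-!
# The Satake isomorphism of the split orthogonal group `O_N(J₀)` in every rank, over every commutative ring containing a
# unit square root of `q`: `𝒮_w : ℋ(O_N(J₀), K₀; R) ⥲ R[Λ⁻]^W` (Satake 1963 §6 Thm. 7, §§8–9; Cartier 1979 §IV Thm. 4.1)

Topic `NumberTheory/Automorphic`; namespace `Literature.NumberTheory.Automorphic.HermitianLattice[.UnramifiedLocalConjDatum]`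
(lane `lit-hodgefound`, Track 2 foundations; seat `lit-hodgefound-p11`, generation 49, row g49-#3).  Two DEFINITIONS with bodies
(`satakeAlgEquivOfForallMem`, the isomorphism attached to any weight whose transforms are Weyl-invariant, and its instance
`satakeAlgEquivOrthogonal`) + theorems; no named fact, no instance, no notation.

## The mathematics

Let `K ⊃ 𝒪 ∋ ϖ` carry an unramified datum `hd : UnramifiedLocalConjDatum σ ϖ` (ANY `σ`: `σ ≠ id` is the quasi-split unitary
group `U_N`, `σ = id` the split orthogonal group `O_N(J₀)`, `SplitOrthogonalUnramifiedDatum`) with finite residue field,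
`G = U(σ, J₀^{(N)})`, `K₀ = G ∩ GL_N(𝒪)`, `𝒮_w = hd.isIwasawaExponent.satakeTransform w : ℋ(G, K₀; R) → R[ℤ^N]` the Satake
transform with a weight `w`, and `R[Λ⁻]^W = unitarySatakeTarget R N` (`Λ⁻` the antisymmetric cocharacters, `W = C_{S_N}(rev)`).

**A SURJECTIVITY CRITERION (§2).**  If every transform `𝒮_w(T)` lies in `R[Λ⁻]^W`, then `𝒮_w` maps ONTO `R[Λ⁻]^W`, hence
(injectivity over every `R`: `satakeTransform_injective_of_commRing`, Bruhat–Tits (4.4.4) (ii)) is an `R`-algebra isomorphism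
`ℋ(G, K₀; R) ⥲ R[Λ⁻]^W`.  Indeed `W ∋ rev` acts as `-1` on `Λ⁻`, so `𝒮_w(T)_{-μ} = 𝒮_w(T)_μ`; the coefficient of `x^a` (`a` dominant)
in the transform of the ANTIDOMINANT Cartan operator `T_{-a}` therefore equals that of `x^{-a}`, the UNIT `w(-a)` (exactly one coset
of `K₀ϖ^{-a}K₀` has exponents `-a`, `coeff_satakeTransform_doubleCosetOperator_zpowDiagGL_monotone_unitary`), its exponents lie
dominance-below `a` ((4.4.4) (i) from the antidominant end + the symmetry), and Cartier's triangular induction on `#U(f)` runs over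
`R` (as in `HyperspecialUnitarySatakeIsomorphismIntegral`, which is the case `σ ≠ id`, `w = q_F^{-⟨ν,·⟩}`).

**THE SATAKE ISOMORPHISM FOR `O_N(J₀)` (§3).**  For `σ = id` (non-dyadic, residue field of `q` elements), every commutative ring
`R`, every `u ∈ Rˣ` with `u² = q` and the orthogonal weight `w = u^{-Λ}`, `Λ(e) = ∑_{i<j, i<j'} (e_i - e_j)`, the transforms are
`W`-invariant (`SplitOrthogonalSatakeWeylInvariance`), so **`𝒮_w : ℋ(O_N(J₀), K₀; R) ⥲ R[Λ⁻]^W` is an isomorphism of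
`R`-algebras** — Satake's theorem for the orthogonal group of the split form `J₀` in `N` variables (`W = W(B_m)`, `N = 2m+1`;
for `N = 2m` the full signed permutation group, the disconnected `O_{2m}` containing the outer automorphism of `D_m`); in
particular over `ℂ` (`u = √q`) and at every finite place `v ∤ 2` of a number field (§4).

## What is formalised

* §1 `coeff_neg_eq_of_mem_unitarySatakeTarget` (`f ∈ R[Λ⁻]^W ⇒ f_{-μ} = f_μ`).
* §2 (any `σ`, weight `w` with `hmem : ∀ T, 𝒮_w(T) ∈ R[Λ⁻]^W`) `coeff_satakeTransform_doubleCosetOperator_zpowDiagGL_neg_of_forall_mem`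
  (leading coefficient `w(-a)`), `headSum_le_of_coeff_satakeTransform_ne_zero_of_forall_mem` (triangularity),
  **`exists_isIwasawaExponent_satakeTransform_eq_of_forall_mem`** (SURJECTIVITY), `range_satakeTransform_eq_unitarySatakeTarget_of_forall_mem`,
  **`satakeAlgEquivOfForallMem : ℋ(G, K₀; R) ≃ₐ[R] R[Λ⁻]^W`**, `coe_satakeAlgEquivOfForallMem`.
* §3 (`σ = id`) **`satakeAlgEquivOrthogonal`** (THE SATAKE ISOMORPHISM OF `O_N(J₀)` over `R ∋ u`, `u² = q`), `coe_satakeAlgEquivOrthogonal`,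
  **`range_satakeTransform_eq_unitarySatakeTarget_orthogonal`**, `exists_satakeTransform_eq_orthogonal`,
  `nonempty_algEquiv_orthogonal_of_sq_eq`, **`nonempty_algEquiv_orthogonal_complex`** (`R = ℂ`, `u = √q`).
* §4 (a number field `E`, a finite place `v ∤ 2`) **`splitOrthogonal_nonempty_algEquiv_adicCompletion`**
  (`ℋ(O_N(J₀)(E_v), K₀; ℂ) ≅ ℂ[Λ⁻]^W`).

## References
* [Satake1963] I. Satake, *Theory of spherical functions on reductive algebraic groups over 𝔭-adic fields*, Publ. Math. IHÉS 18
  (1963), §6 Thm. 7, §§8–9 (orthogonal groups).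
* [CartierCorvallis1979] P. Cartier, *Representations of 𝔭-adic groups: a survey*, PSPM 33.1 (1979), §IV Thm. 4.1 and its proof
  (a)–(c).
* [BruhatTits1972] F. Bruhat, J. Tits, *Groupes réductifs sur un corps local I*, Publ. Math. IHÉS 41 (1972), (4.4.3), (4.4.4).
* [GrossSatake1998] B. H. Gross, *On the Satake isomorphism*, LMS Lecture Notes 254 (1998), Prop. 3.6, (3.8)–(3.9).
* [Tits1979] J. Tits, *Reductive groups over local fields*, PSPM 33.1 (1979), §3.3.3.
-/

noncomputable section

open scoped Valued WithZero Matrix MatrixGroups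
open MonoidAlgebra Representation NumberField IsDedekindDomain

namespace Literature.NumberTheory.Automorphic.HermitianLattice

open Literature.NumberTheory.Automorphic Literature.NumberTheory.Automorphic.CartanUnique
  Literature.NumberTheory.Automorphic.SymplecticCartan

variable {N : ℕ} {R : Type*} [CommRing R]

/-! ## §1 `rev ∈ W` acts as `-1` on the antisymmetric lattice -/

/-- **`f ∈ R[Λ⁻]^W ⇒ f_{-μ} = f_μ`**: on the antisymmetric lattice `-μ = μ ∘ rev` with `rev ∈ W = C_{S_N}(rev)`; off it both
coefficients vanish. [cite: CartierCorvallis1979, §IV Thm. 4.1] [cite: BruhatTits1972, (4.4.3)] -/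
theorem coeff_neg_eq_of_mem_unitarySatakeTarget {f : AddMonoidAlgebra R (Fin N → ℤ)} (hf : f ∈ unitarySatakeTarget R N)
    (μ : Fin N → ℤ) : f.coeff (-μ) = f.coeff μ := by
  obtain ⟨hsupp, hW⟩ := (mem_unitarySatakeTarget_iff f).1 hf
  by_cases hμ : ∀ i, μ (Fin.rev i) = -μ i
  · rw [show -μ = μ ∘ ⇑(Fin.revPerm : Equiv.Perm (Fin N)) from
      funext fun i => by simp only [Pi.neg_apply, Function.comp_apply, Fin.revPerm_apply, hμ i]]
    exact hW Fin.revPerm revPerm_rev μ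
  · have hμ' : ¬ ∀ i, (-μ) (Fin.rev i) = -(-μ) i := fun h => hμ fun i => by
      have := h i; rw [Pi.neg_apply, Pi.neg_apply] at this; omega
    rw [hsupp μ hμ, hsupp _ hμ']

/-! ## §2 A surjectivity criterion: Weyl-invariant transforms fill `R[Λ⁻]^W` -/

section Criterion

variable {K : Type*} [Field K] [Valued K ℤᵐ⁰] {σ : K →+* K} {ϖ : K}

namespace UnramifiedLocalConjDatum

variable [IsHeckeTriple (⊤ : Submonoid (unitaryGroupOfForm σ ((StdForm.antidiagonal N).over K)))
    (unitaryInt σ ((StdForm.antidiagonal N).over K)) (unitaryInt σ ((StdForm.antidiagonal N).over K))]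

/-- **The coefficient of `x^a` in `𝒮_w(T_{-a})` is the unit `w(-a)`** (`a` dominant), for any weight `w` whose transforms lie in
`R[Λ⁻]^W`: it equals the coefficient of `x^{-a}` (§1), and exactly one coset of `K₀ diag(ϖ^{-a}) K₀` has the antidominant exponents
`-a`. [cite: CartierCorvallis1979, §IV, proof of Thm. 4.1 (c)] [cite: BruhatTits1972, (4.4.4) (ii)] -/
theorem coeff_satakeTransform_doubleCosetOperator_zpowDiagGL_neg_of_forall_mem (hd : UnramifiedLocalConjDatum σ ϖ)
    (w : Multiplicative (Fin N → ℤ) →* R)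
    (hmem : ∀ T : heckeAlgebra R (unitaryGroupOfForm σ ((StdForm.antidiagonal N).over K)) (unitaryInt σ ((StdForm.antidiagonal N).over K)),
      (hd.isIwasawaExponent (N := N)).satakeTransform w T ∈ unitarySatakeTarget R N)
    {a : Fin N → ℤ} (ha : Antitone a ∧ ∀ i, a (Fin.rev i) = -a i) :
    ((hd.isIwasawaExponent (N := N)).satakeTransform w
        (heckeAlgebra.doubleCosetOperator (unitaryInt σ ((StdForm.antidiagonal N).over K))
          (⟨zpowDiagGL (uniformizer_ne_zero hd.vϖ) (-a), zpowDiagGL_mem_unitaryGroupOfForm hd.σϖ _ (neg_rev_of_rev ha.2)⟩ :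
            unitaryGroupOfForm σ ((StdForm.antidiagonal N).over K)))).coeff a =
      w (Multiplicative.ofAdd (-a)) := by
  have hc : Monotone (-a) ∧ ∀ i, (-a) (Fin.rev i) = -(-a) i := ⟨fun i j hij => neg_le_neg (ha.1 hij), neg_rev_of_rev ha.2⟩
  have h := coeff_neg_eq_of_mem_unitarySatakeTarget (hmem
    (heckeAlgebra.doubleCosetOperator (unitaryInt σ ((StdForm.antidiagonal N).over K))
      (⟨zpowDiagGL (uniformizer_ne_zero hd.vϖ) (-a), zpowDiagGL_mem_unitaryGroupOfForm hd.σϖ _ (neg_rev_of_rev ha.2)⟩ :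
        unitaryGroupOfForm σ ((StdForm.antidiagonal N).over K)))) (-a)
  rw [neg_neg] at h
  rw [h]
  exact hd.coeff_satakeTransform_doubleCosetOperator_zpowDiagGL_monotone_unitary w hc rfl

/-- **Triangularity of `𝒮_w(T_{-a})` below `a`** (`a` dominant; any weight with Weyl-invariant transforms): if `x^μ` occurs in
`𝒮_w(T_{-a})` then `∑_{i<r} μ_i ≤ ∑_{i<r} a_i` for all `r`. [cite: CartierCorvallis1979, §IV, proof of Thm. 4.1 (c)]
[cite: BruhatTits1972, (4.4.4) (i)] -/
theorem headSum_le_of_coeff_satakeTransform_ne_zero_of_forall_mem (hd : UnramifiedLocalConjDatum σ ϖ)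
    (w : Multiplicative (Fin N → ℤ) →* R)
    (hmem : ∀ T : heckeAlgebra R (unitaryGroupOfForm σ ((StdForm.antidiagonal N).over K)) (unitaryInt σ ((StdForm.antidiagonal N).over K)),
      (hd.isIwasawaExponent (N := N)).satakeTransform w T ∈ unitarySatakeTarget R N)
    {a : Fin N → ℤ} (ha : Antitone a ∧ ∀ i, a (Fin.rev i) = -a i) {μ : Fin N → ℤ}
    (hμ : ((hd.isIwasawaExponent (N := N)).satakeTransform w
        (heckeAlgebra.doubleCosetOperator (unitaryInt σ ((StdForm.antidiagonal N).over K))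
          (⟨zpowDiagGL (uniformizer_ne_zero hd.vϖ) (-a), zpowDiagGL_mem_unitaryGroupOfForm hd.σϖ _ (neg_rev_of_rev ha.2)⟩ :
            unitaryGroupOfForm σ ((StdForm.antidiagonal N).over K)))).coeff μ ≠ 0) (r : ℕ) :
    headSum μ r ≤ headSum a r := by
  have hc : Monotone (-a) ∧ ∀ i, (-a) (Fin.rev i) = -(-a) i := ⟨fun i j hij => neg_le_neg (ha.1 hij), neg_rev_of_rev ha.2⟩
  -- pass to `-μ`, whose coefficient is non-zero too
  rw [← coeff_neg_eq_of_mem_unitarySatakeTarget (hmem _) μ] at hμ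
  -- some coset of `K₀ diag(ϖ^{-a}) K₀` has exponents `-μ`
  obtain ⟨γ, hγ, hγμ⟩ : ∃ γ : unitaryGroupOfForm σ ((StdForm.antidiagonal N).over K) ⧸ unitaryInt σ ((StdForm.antidiagonal N).over K),
      γ ∈ MulAction.orbit (unitaryInt σ ((StdForm.antidiagonal N).over K))
        (((⟨zpowDiagGL (uniformizer_ne_zero hd.vϖ) (-a), zpowDiagGL_mem_unitaryGroupOfForm hd.σϖ _ (neg_rev_of_rev ha.2)⟩ :
            unitaryGroupOfForm σ ((StdForm.antidiagonal N).over K)) :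
          unitaryGroupOfForm σ ((StdForm.antidiagonal N).over K) ⧸ unitaryInt σ ((StdForm.antidiagonal N).over K))) ∧
        hd.iwasawaExp γ.out = -μ := by
    by_contra h
    push Not at h
    exact hμ ((hd.isIwasawaExponent (N := N)).coeff_satakeTransform_doubleCosetOperator_eq_zero w h)
  have hγ' : ((γ.out : unitaryGroupOfForm σ ((StdForm.antidiagonal N).over K)) :
      unitaryGroupOfForm σ ((StdForm.antidiagonal N).over K) ⧸ unitaryInt σ ((StdForm.antidiagonal N).over K)) ∈
      MulAction.orbit (unitaryInt σ ((StdForm.antidiagonal N).over K))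
        (((⟨zpowDiagGL (uniformizer_ne_zero hd.vϖ) (-a), zpowDiagGL_mem_unitaryGroupOfForm hd.σϖ _ (neg_rev_of_rev ha.2)⟩ :
            unitaryGroupOfForm σ ((StdForm.antidiagonal N).over K)) :
          unitaryGroupOfForm σ ((StdForm.antidiagonal N).over K) ⧸ unitaryInt σ ((StdForm.antidiagonal N).over K))) := by
    rwa [QuotientGroup.out_eq']
  have h1 := hd.sum_ite_lt_le_sum_iwasawaExp_of_mem_orbit hc rfl hγ' r
  rw [hγμ, ← headSum_eq, ← headSum_eq, headSum_neg, headSum_neg] at h1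
  exact neg_le_neg_iff.1 h1

/-- **SURJECTIVITY CRITERION**: if every transform `𝒮_w(T)` lies in `R[Λ⁻]^W`, then every `f ∈ R[Λ⁻]^W` is a transform — Cartier's
triangular induction on `#U(f)`, subtracting `f_a w(-a)⁻¹ 𝒮_w(T_{-a})` for the head-sum-maximal (hence dominant) exponent
`a ∈ supp f`; any `σ`, any commutative `R`, only the units `w(-a)` are inverted. [cite: CartierCorvallis1979, §IV Thm. 4.1 and its proof (c)]
[cite: Satake1963, §6 Thm. 7] [cite: BruhatTits1972, (4.4.4)] [cite: GrossSatake1998, Prop. 3.6, (3.8)–(3.9)] -/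
theorem exists_isIwasawaExponent_satakeTransform_eq_of_forall_mem (hd : UnramifiedLocalConjDatum σ ϖ)
    (w : Multiplicative (Fin N → ℤ) →* R)
    (hmem : ∀ T : heckeAlgebra R (unitaryGroupOfForm σ ((StdForm.antidiagonal N).over K)) (unitaryInt σ ((StdForm.antidiagonal N).over K)),
      (hd.isIwasawaExponent (N := N)).satakeTransform w T ∈ unitarySatakeTarget R N)
    (f : AddMonoidAlgebra R (Fin N → ℤ)) (hf : f ∈ unitarySatakeTarget R N) :
    ∃ T : heckeAlgebra R (unitaryGroupOfForm σ ((StdForm.antidiagonal N).over K)) (unitaryInt σ ((StdForm.antidiagonal N).over K)),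
      (hd.isIwasawaExponent (N := N)).satakeTransform w T = f := by
  classical
  suffices H : ∀ (m : ℕ) (f : AddMonoidAlgebra R (Fin N → ℤ)), f ∈ unitarySatakeTarget R N →
      (finite_lowerDominantSet f).toFinset.card = m →
      ∃ T : heckeAlgebra R (unitaryGroupOfForm σ ((StdForm.antidiagonal N).over K)) (unitaryInt σ ((StdForm.antidiagonal N).over K)),
        (hd.isIwasawaExponent (N := N)).satakeTransform w T = f from H _ f hf rfl
  intro m
  induction m using Nat.strong_induction_on with
  | _ m ih =>
  intro f hf hm
  by_cases h0 : f = 0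
  · exact ⟨0, by rw [h0, map_zero]⟩
  obtain ⟨hsupp, hW⟩ := (mem_unitarySatakeTarget_iff f).1 hf
  -- the head-sum-maximal exponent `a ∈ supp f` is dominant
  have hSne : f.coeff.support.Nonempty := by
    rw [Finsupp.support_nonempty_iff, ne_eq, AddMonoidAlgebra.coeff_eq_zero]
    exact h0
  obtain ⟨a, haS, hmax⟩ := f.coeff.support.exists_max_image (fun μ => toLex (headSumVec μ)) hSne
  have haS' : f.coeff a ≠ 0 := Finsupp.mem_support_iff.1 haS
  have hanti : ∀ μ ∈ f.coeff.support, ∀ i, μ (Fin.rev i) = -μ i := fun μ hμ => by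
    by_contra h
    exact Finsupp.mem_support_iff.1 hμ (hsupp μ h)
  have hstab : ∀ μ ∈ f.coeff.support, ∀ π : Equiv.Perm (Fin N), (∀ i, π (Fin.rev i) = Fin.rev (π i)) → μ ∘ π ∈ f.coeff.support :=
    fun μ hμ π hπ => by
      rw [Finsupp.mem_support_iff] at hμ ⊢
      rwa [hW π hπ μ]
  have hmono : Antitone a := antitone_of_isMaxOn_headSumVec hstab hanti haS hmax
  have ha : Antitone a ∧ ∀ i, a (Fin.rev i) = -a i := ⟨hmono, hanti a haS⟩
  -- the antidominant operator `T_{-a}` and its transform `F = v x^a + lower terms`, `v = w(-a)` a unit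
  set Ta : heckeAlgebra R (unitaryGroupOfForm σ ((StdForm.antidiagonal N).over K)) (unitaryInt σ ((StdForm.antidiagonal N).over K)) :=
    heckeAlgebra.doubleCosetOperator (unitaryInt σ ((StdForm.antidiagonal N).over K))
      (⟨zpowDiagGL (uniformizer_ne_zero hd.vϖ) (-a), zpowDiagGL_mem_unitaryGroupOfForm hd.σϖ _ (neg_rev_of_rev ha.2)⟩ :
        unitaryGroupOfForm σ ((StdForm.antidiagonal N).over K)) with hTa
  set F := (hd.isIwasawaExponent (N := N)).satakeTransform w Ta with hFdef
  obtain ⟨v, hv⟩ := IsIwasawaExponent.isUnit_weight w (Multiplicative.ofAdd (-a))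
  have hc : F.coeff a = (v : R) := by
    rw [hv, hFdef, hTa]
    exact hd.coeff_satakeTransform_doubleCosetOperator_zpowDiagGL_neg_of_forall_mem w hmem ha
  have htri : ∀ μ, F.coeff μ ≠ 0 → ∀ r, headSum μ r ≤ headSum a r := fun μ hμ r =>
    hd.headSum_le_of_coeff_satakeTransform_ne_zero_of_forall_mem w hmem ha hμ r
  have hF : F ∈ unitarySatakeTarget R N := hmem Ta
  -- `g = f - f_a v⁻¹ F`
  set k : R := f.coeff a * ((v⁻¹ : Rˣ) : R) with hk
  set g := f - k • F with hgdef
  have hg : g ∈ unitarySatakeTarget R N := Subalgebra.sub_mem _ hf (Subalgebra.smul_mem _ hF k)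
  have hgcoeff : ∀ μ, g.coeff μ = f.coeff μ - k * F.coeff μ := fun μ => by
    rw [hgdef, AddMonoidAlgebra.coeff_sub, AddMonoidAlgebra.coeff_smul, Finsupp.sub_apply, Finsupp.smul_apply, smul_eq_mul]
  have hga : g.coeff a = 0 := by rw [hgcoeff, hk, hc, Units.inv_mul_cancel_right, sub_self]
  have hgsupp : ∀ μ, g.coeff μ ≠ 0 → f.coeff μ ≠ 0 ∨ F.coeff μ ≠ 0 := fun μ h => by
    by_contra h'
    rw [not_or, not_ne_iff, not_ne_iff] at h'
    exact h (by rw [hgcoeff, h'.1, h'.2, mul_zero, sub_zero])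
  -- `U(g) ⊊ U(f)`
  have hsub : lowerDominantSet g ⊆ lowerDominantSet f := by
    rintro la ⟨h1, h2, b, hb, hbm, hle⟩
    rcases hgsupp b hb with hbf | hbF
    · exact ⟨h1, h2, b, hbf, hbm, hle⟩
    · exact ⟨h1, h2, a, haS', hmono, fun r => (hle r).trans (htri b hbF r)⟩
  have haU : a ∈ lowerDominantSet f := ⟨hmono, ha.2, a, haS', hmono, fun _ => le_rfl⟩
  have haU' : a ∉ lowerDominantSet g := by
    rintro ⟨-, -, b, hb, -, hle⟩
    have hba : a = b := by
      rcases hgsupp b hb with hbf | hbF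
      · exact eq_of_headSum_le_of_toLex_le hle (hmax b (Finsupp.mem_support_iff.2 hbf))
      · exact eq_of_headSum_le_antisymm hle (htri b hbF)
    rw [← hba] at hb
    exact hb hga
  have hlt : (finite_lowerDominantSet g).toFinset.card < (finite_lowerDominantSet f).toFinset.card :=
    Finset.card_lt_card (Set.Finite.toFinset_ssubset_toFinset.2 ((Set.ssubset_iff_of_subset hsub).2 ⟨a, haU, haU'⟩))
  obtain ⟨T', hT'⟩ := ih _ (hm ▸ hlt) g hg rfl
  refine ⟨T' + k • Ta, ?_⟩
  rw [map_add, map_smul, hT', hgdef, sub_add_cancel]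

/-- **`range 𝒮_w = R[Λ⁻]^W`** as soon as `range 𝒮_w ⊆ R[Λ⁻]^W` (any `σ`, any commutative `R`). [cite: CartierCorvallis1979, §IV Thm. 4.1]
[cite: Satake1963, §6 Thm. 7] -/
theorem range_satakeTransform_eq_unitarySatakeTarget_of_forall_mem (hd : UnramifiedLocalConjDatum σ ϖ)
    (w : Multiplicative (Fin N → ℤ) →* R)
    (hmem : ∀ T : heckeAlgebra R (unitaryGroupOfForm σ ((StdForm.antidiagonal N).over K)) (unitaryInt σ ((StdForm.antidiagonal N).over K)),
      (hd.isIwasawaExponent (N := N)).satakeTransform w T ∈ unitarySatakeTarget R N) :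
    ((hd.isIwasawaExponent (N := N)).satakeTransform w).range = unitarySatakeTarget R N :=
  le_antisymm (by rintro f ⟨T, rfl⟩; exact hmem T)
    fun f hf => (AlgHom.mem_range _).2 (hd.exists_isIwasawaExponent_satakeTransform_eq_of_forall_mem w hmem f hf)

/-- **The Satake isomorphism attached to a weight with Weyl-invariant transforms**: `𝒮_w : ℋ(U(σ, J₀^{(N)}), K₀; R) ⥲ R[Λ⁻]^W`
(injective over every `R` by `satakeTransform_injective_of_commRing`, onto by the criterion). [cite: CartierCorvallis1979, §IV Thm. 4.1]
[cite: Satake1963, §6 Thm. 7] -/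
def satakeAlgEquivOfForallMem (hd : UnramifiedLocalConjDatum σ ϖ) (w : Multiplicative (Fin N → ℤ) →* R)
    (hmem : ∀ T : heckeAlgebra R (unitaryGroupOfForm σ ((StdForm.antidiagonal N).over K)) (unitaryInt σ ((StdForm.antidiagonal N).over K)),
      (hd.isIwasawaExponent (N := N)).satakeTransform w T ∈ unitarySatakeTarget R N) :
    heckeAlgebra R (unitaryGroupOfForm σ ((StdForm.antidiagonal N).over K)) (unitaryInt σ ((StdForm.antidiagonal N).over K)) ≃ₐ[R]
      unitarySatakeTarget R N :=
  AlgEquiv.ofBijective (((hd.isIwasawaExponent (N := N)).satakeTransform w).codRestrict (unitarySatakeTarget R N) hmem)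
    ⟨fun T T' h => hd.satakeTransform_injective_of_commRing w (congrArg Subtype.val h),
      fun f => by
        obtain ⟨T, hT⟩ := hd.exists_isIwasawaExponent_satakeTransform_eq_of_forall_mem w hmem f.1 f.2
        exact ⟨T, Subtype.ext hT⟩⟩

/-- The isomorphism of the criterion is the Satake transform `𝒮_w`. [cite: CartierCorvallis1979, §IV Thm. 4.1] -/
@[simp] theorem coe_satakeAlgEquivOfForallMem (hd : UnramifiedLocalConjDatum σ ϖ) (w : Multiplicative (Fin N → ℤ) →* R)
    (hmem : ∀ T : heckeAlgebra R (unitaryGroupOfForm σ ((StdForm.antidiagonal N).over K)) (unitaryInt σ ((StdForm.antidiagonal N).over K)),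
      (hd.isIwasawaExponent (N := N)).satakeTransform w T ∈ unitarySatakeTarget R N)
    (T : heckeAlgebra R (unitaryGroupOfForm σ ((StdForm.antidiagonal N).over K)) (unitaryInt σ ((StdForm.antidiagonal N).over K))) :
    ((hd.satakeAlgEquivOfForallMem w hmem T : unitarySatakeTarget R N) : AddMonoidAlgebra R (Fin N → ℤ)) =
      (hd.isIwasawaExponent (N := N)).satakeTransform w T := rfl

end UnramifiedLocalConjDatum

end Criterion

/-! ## §3 The Satake isomorphism of `O_N(J₀)` -/

section Orthogonal

variable {K : Type*} [Field K] [Valued K ℤᵐ⁰] {ϖ : K}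

namespace UnramifiedLocalConjDatum

/-- **THE SATAKE ISOMORPHISM OF THE SPLIT ORTHOGONAL GROUP `O_N(J₀)` IN EVERY RANK**: for a non-dyadic unramified datum for
`σ = id` with finite residue field of `q` elements, every commutative ring `R`, every `u ∈ Rˣ` with `u² = q` and the orthogonal
weight `w(e) = u^{-Λ(e)}`, `Λ(e) = ∑_{i<j, i<j'} (e_i - e_j)`:  `𝒮_w : ℋ(O_N(J₀), K₀; R) ⥲ R[Λ⁻]^W`, an isomorphism of `R`-algebras
onto the invariants of the signed permutation group `W = C_{S_N}(rev)` in the group algebra of the antisymmetric cocharacters.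
[cite: Satake1963, §6 Thm. 7, §§8–9] [cite: CartierCorvallis1979, §IV Thm. 4.1] [cite: Tits1979, §3.3.3] -/
def satakeAlgEquivOrthogonal (hd : UnramifiedLocalConjDatum (RingHom.id K) ϖ) [Finite 𝓀[K]] (u : Rˣ)
    (hu : (u : R) ^ 2 = Nat.card 𝓀[K]) (w : Multiplicative (Fin N → ℤ) →* R)
    (hw : ∀ e : Fin N → ℤ, w (Multiplicative.ofAdd e) =
      ((u ^ (-∑ p ∈ (Finset.univ : Finset (Fin N × Fin N)) with (p.1 < p.2 ∧ p.1 < Fin.rev p.2), (e p.1 - e p.2)) : Rˣ) : R)) :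
    heckeAlgebra R (unitaryGroupOfForm (RingHom.id K) ((StdForm.antidiagonal N).over K))
        (unitaryInt (RingHom.id K) ((StdForm.antidiagonal N).over K)) ≃ₐ[R] unitarySatakeTarget R N :=
  haveI := isHeckeTriple_unitaryInt_of_finite_residueField hd.vϖ (RingHom.id K) ((StdForm.antidiagonal N).over K)
  hd.satakeAlgEquivOfForallMem w fun T => hd.isIwasawaExponent_satakeTransform_mem_unitarySatakeTarget_orthogonal u hu w hw T

/-- The Satake isomorphism of `O_N(J₀)` is the orthogonally normalised Satake transform. [cite: Satake1963, §6 Thm. 7] -/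
@[simp] theorem coe_satakeAlgEquivOrthogonal (hd : UnramifiedLocalConjDatum (RingHom.id K) ϖ) [Finite 𝓀[K]] (u : Rˣ)
    (hu : (u : R) ^ 2 = Nat.card 𝓀[K]) (w : Multiplicative (Fin N → ℤ) →* R)
    (hw : ∀ e : Fin N → ℤ, w (Multiplicative.ofAdd e) =
      ((u ^ (-∑ p ∈ (Finset.univ : Finset (Fin N × Fin N)) with (p.1 < p.2 ∧ p.1 < Fin.rev p.2), (e p.1 - e p.2)) : Rˣ) : R))
    (T : heckeAlgebra R (unitaryGroupOfForm (RingHom.id K) ((StdForm.antidiagonal N).over K))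
      (unitaryInt (RingHom.id K) ((StdForm.antidiagonal N).over K))) :
    ((hd.satakeAlgEquivOrthogonal u hu w hw T : unitarySatakeTarget R N) : AddMonoidAlgebra R (Fin N → ℤ)) =
      (hd.isIwasawaExponent (N := N)).satakeTransform w T := rfl

/-- **Every `f ∈ R[Λ⁻]^W` is an orthogonally normalised Satake transform of `O_N(J₀)`** (`u² = q`, `w = u^{-Λ}`).
[cite: Satake1963, §6 Thm. 7, §§8–9] [cite: CartierCorvallis1979, §IV Thm. 4.1] -/
theorem exists_satakeTransform_eq_orthogonal (hd : UnramifiedLocalConjDatum (RingHom.id K) ϖ) [Finite 𝓀[K]] (u : Rˣ)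
    (hu : (u : R) ^ 2 = Nat.card 𝓀[K]) (w : Multiplicative (Fin N → ℤ) →* R)
    (hw : ∀ e : Fin N → ℤ, w (Multiplicative.ofAdd e) =
      ((u ^ (-∑ p ∈ (Finset.univ : Finset (Fin N × Fin N)) with (p.1 < p.2 ∧ p.1 < Fin.rev p.2), (e p.1 - e p.2)) : Rˣ) : R))
    (f : AddMonoidAlgebra R (Fin N → ℤ)) (hf : f ∈ unitarySatakeTarget R N) :
    ∃ T : heckeAlgebra R (unitaryGroupOfForm (RingHom.id K) ((StdForm.antidiagonal N).over K))
        (unitaryInt (RingHom.id K) ((StdForm.antidiagonal N).over K)),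
      (hd.isIwasawaExponent (N := N)).satakeTransform w T = f := by
  haveI := isHeckeTriple_unitaryInt_of_finite_residueField hd.vϖ (RingHom.id K) ((StdForm.antidiagonal N).over K)
  exact hd.exists_isIwasawaExponent_satakeTransform_eq_of_forall_mem w
    (fun T => hd.isIwasawaExponent_satakeTransform_mem_unitarySatakeTarget_orthogonal u hu w hw T) f hf

/-- **`range 𝒮_w = R[Λ⁻]^W` for `O_N(J₀)`** (`u² = q`, `w = u^{-Λ}`). [cite: Satake1963, §6 Thm. 7, §§8–9]
[cite: CartierCorvallis1979, §IV Thm. 4.1] -/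
theorem range_satakeTransform_eq_unitarySatakeTarget_orthogonal (hd : UnramifiedLocalConjDatum (RingHom.id K) ϖ) [Finite 𝓀[K]]
    (u : Rˣ) (hu : (u : R) ^ 2 = Nat.card 𝓀[K]) (w : Multiplicative (Fin N → ℤ) →* R)
    (hw : ∀ e : Fin N → ℤ, w (Multiplicative.ofAdd e) =
      ((u ^ (-∑ p ∈ (Finset.univ : Finset (Fin N × Fin N)) with (p.1 < p.2 ∧ p.1 < Fin.rev p.2), (e p.1 - e p.2)) : Rˣ) : R)) :
    ((hd.isIwasawaExponent (N := N)).satakeTransform w).range = unitarySatakeTarget R N := by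
  haveI := isHeckeTriple_unitaryInt_of_finite_residueField hd.vϖ (RingHom.id K) ((StdForm.antidiagonal N).over K)
  exact hd.range_satakeTransform_eq_unitarySatakeTarget_of_forall_mem w
    fun T => hd.isIwasawaExponent_satakeTransform_mem_unitarySatakeTarget_orthogonal u hu w hw T

/-- **`ℋ(O_N(J₀), K₀; R) ≅ R[Λ⁻]^W` whenever `R` contains a unit square root of `q`.** [cite: Satake1963, §6 Thm. 7, §§8–9]
[cite: CartierCorvallis1979, §IV Thm. 4.1] -/
theorem nonempty_algEquiv_orthogonal_of_sq_eq (hd : UnramifiedLocalConjDatum (RingHom.id K) ϖ) [Finite 𝓀[K]]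
    (hq : ∃ u : Rˣ, (u : R) ^ 2 = Nat.card 𝓀[K]) :
    Nonempty (heckeAlgebra R (unitaryGroupOfForm (RingHom.id K) ((StdForm.antidiagonal N).over K))
        (unitaryInt (RingHom.id K) ((StdForm.antidiagonal N).over K)) ≃ₐ[R] unitarySatakeTarget R N) := by
  obtain ⟨u, hu⟩ := hq
  obtain ⟨w, hw⟩ := exists_weight_units_zpow_neg_orthogonal (N := N) (R := R) u
  exact ⟨hd.satakeAlgEquivOrthogonal u hu w hw⟩

/-- **THE COMPLEX SATAKE ISOMORPHISM OF `O_N(J₀)`**: `ℋ(O_N(J₀), K₀; ℂ) ≅ ℂ[Λ⁻]^W` (`u = √q ∈ ℂˣ`). [cite: Satake1963, §6 Thm. 7, §§8–9]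
[cite: CartierCorvallis1979, §IV Thm. 4.1] -/
theorem nonempty_algEquiv_orthogonal_complex (hd : UnramifiedLocalConjDatum (RingHom.id K) ϖ) [Finite 𝓀[K]] :
    Nonempty (heckeAlgebra ℂ (unitaryGroupOfForm (RingHom.id K) ((StdForm.antidiagonal N).over K))
        (unitaryInt (RingHom.id K) ((StdForm.antidiagonal N).over K)) ≃ₐ[ℂ] unitarySatakeTarget ℂ N) :=
  hd.nonempty_algEquiv_orthogonal_of_sq_eq ⟨Units.mk0 (residueCardSqrt K) residueCardSqrt_ne_zero, by
    rw [Units.val_mk0, residueCardSqrt_sq]⟩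

end UnramifiedLocalConjDatum

end Orthogonal

/-! ## §4 At the finite places `v ∤ 2` of a number field -/

section NumberField

variable {E : Type} [Field E] [NumberField E] (v : HeightOneSpectrum (𝓞 E))

/-- **`ℋ(O_N(J₀)(E_v), K₀; ℂ) ≅ ℂ[Λ⁻]^W` at every finite place `v ∤ 2` of a number field `E`** (the `σ = id` datum of
`SplitOrthogonalUnramifiedDatum` at `v`; residue-field finiteness from `finite_residueField_adicCompletion`).
[cite: Satake1963, §6 Thm. 7, §§8–9] [cite: CartierCorvallis1979, §IV Thm. 4.1] [cite: Tits1979, §3.3.3] -/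
theorem splitOrthogonal_nonempty_algEquiv_adicCompletion (h2 : (2 : 𝓞 E) ∉ v.asIdeal) :
    Nonempty (heckeAlgebra ℂ (unitaryGroupOfForm (RingHom.id (v.adicCompletion E)) ((StdForm.antidiagonal N).over (v.adicCompletion E)))
        (unitaryInt (RingHom.id (v.adicCompletion E)) ((StdForm.antidiagonal N).over (v.adicCompletion E))) ≃ₐ[ℂ]
      unitarySatakeTarget ℂ N) := by
  haveI := finite_residueField_adicCompletion E v
  obtain ⟨ϖ, hd⟩ := exists_unramifiedLocalConjDatum_id_adicCompletion v h2
  exact hd.nonempty_algEquiv_orthogonal_complex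

end NumberField

end Literature.NumberTheory.Automorphic.HermitianLattice

end
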